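import Literature.NumberTheory.ModularForms.QAsymptotics2
import Literature.NumberTheory.ModularForms.JacobiThetaGammaTwo
import HarnessLib

/-!
# Second-order asymptotics of `U, V, W, λ, 𝓛_S, 𝓛` at `i∞` (CKMRV (2.8)–(2.10))

Cohn–Kumar–Miller–Radchenko–Viazovska, arXiv:1902.05438, §2.1.2: (2.8)
`U = 1 + 8q^{1/2} + 24q + ⋯`, `V = 16q^{1/2} + 64q^{3/2} + ⋯`, `W = 1 − 8q^{1/2} + 24q − ⋯`;
(2.9) `λ = 16q^{1/2} − 128q + 704q^{3/2} − ⋯`; (2.10) `𝓛 = πiz + 4 log 2 − 8q^{1/2} + 32q − ⋯`,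
`𝓛_S = −16q^{1/2} − (64/3)q^{3/2} − ⋯` (`q^{1/2} = e^{πiz}`).

Everything below is PROVED, as `IsBigO` statements along `atImInfty` with `qhalf τ = e^{πiτ}`,
`‖qhalf‖ = e^{−πy} = expDecayHalf`:
* `theta3_second_order`: `θ₀₀ − 1 − 2q^{1/2} = O(e^{−4πy})` (tail of the theta series);
* `thetaU_second_order`: `U − 1 − 8q^{1/2} = O(e^{−2πy})`; `thetaW_second_order`:
  `W − 1 + 8q^{1/2} = O(e^{−2πy})` (via `W(τ) = U(τ+1)`); `thetaV_second_order`: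
  `V − 16q^{1/2} = O(e^{−3πy})` (from the tree's `norm_jacobiTheta₂_half_sub_two_le`);
* `modularLambda_second_order`: `λ − 16q^{1/2} + 128q = O(e^{−3πy})`;
* `logLambdaS_second_order`: `𝓛_S + 16q^{1/2} = O(e^{−2πy})` (near `i∞`, `𝓛_S = log(1 − λ)`);
* `logLambda_second_order`: `𝓛 − πiτ − log 16 + 8q^{1/2} = O(e^{−2πy})`
  (near `i∞`, `𝓛 − πiτ − log 16 = log(λe^{−πiτ}/16)`).

## References

* H. Cohn, A. Kumar, S. D. Miller, D. Radchenko, M. Viazovska, Ann. of Math. 196 (2022),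
  arXiv:1902.05438, §2.1.2 (2.8)–(2.10). [CohnEtAl2019]
-/

noncomputable section

open Complex hiding I
open Filter Topology Asymptotics ModularForm SlashInvariantForm
open UpperHalfPlane hiding I
open Complex (I)
open scoped Real MatrixGroups ModularForm Manifold

namespace Literature.NumberTheory.ModularForms

open Literature.NumberTheory.EllipticCurves.JacobiThetaNull (theta2 theta3 theta4 theta3_add_one
  norm_jacobiTheta₂_half_sub_two_le majorant summable_majorant majorant_nonneg tendsto_jacobiTheta₂_half)

/-! ## `q^{1/2} = e^{πiτ}` -/

/-- `q^{1/2}(τ) = e^{πiτ}`. [folklore] -/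
def qhalf (τ : ℍ) : ℂ := cexp (π * I * τ)

/-- `‖q^{1/2}‖ = e^{−πy}`. [folklore] -/
theorem norm_qhalf (τ : ℍ) : ‖qhalf τ‖ = expDecayHalf τ := by
  rw [qhalf, Complex.norm_exp, expDecayHalf]
  congr 1
  simp [Complex.mul_re, UpperHalfPlane.coe_im, UpperHalfPlane.coe_re]

/-- `(q^{1/2})² = q`. [folklore] -/
theorem qhalf_sq (τ : ℍ) : qhalf τ ^ 2 = qfun τ := by
  rw [qhalf, qfun, sq, ← Complex.exp_add]; congr 1; ring

/-- `q^{1/2}(τ + 1) = −q^{1/2}(τ)`. [folklore] -/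
theorem qhalf_vadd_one (τ : ℍ) : qhalf ((1 : ℝ) +ᵥ τ) = -qhalf τ := by
  rw [qhalf, qhalf, UpperHalfPlane.coe_vadd, ofReal_one, mul_add, mul_one, Complex.exp_add, Complex.exp_pi_mul_I]
  ring

/-- `e^{−πy}` is translation invariant. [folklore] -/
theorem expDecayHalf_vadd (x : ℝ) (τ : ℍ) : expDecayHalf (x +ᵥ τ) = expDecayHalf τ := by
  simp [expDecayHalf, UpperHalfPlane.vadd_im]

/-- `e^{−πy} ≤ 1`. [folklore] -/
theorem expDecayHalf_le_one (τ : ℍ) : expDecayHalf τ ≤ 1 := by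
  rw [expDecayHalf, Real.exp_le_one_iff]; nlinarith [Real.pi_pos, τ.im_pos]

/-! ## `θ₀₀ = 1 + 2q^{1/2} + O(q²)` -/

/-- `e^{πi(n+1)²τ} = (q^{1/2})^{(n+1)²}`. [folklore] -/
theorem cexp_sq_eq_qhalf_pow (τ : ℍ) (n : ℕ) :
    cexp (π * I * ((n : ℂ) + 1) ^ 2 * τ) = qhalf τ ^ ((n + 1) ^ 2) := by
  rw [qhalf, ← Complex.exp_nat_mul]; congr 1; push_cast; ring

/-- **`θ₀₀(τ) − 1 − 2q^{1/2} = O(|q^{1/2}|⁴)`**: the tail `2Σ_{n≥2} q^{n²/2}` with `n² ≥ 4(n−1)`… precisely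
`‖θ₀₀ − 1 − 2q^{1/2}‖ ≤ 4‖q^{1/2}‖⁴` once `‖q^{1/2}‖⁴ ≤ 1/2`. [cite: CohnEtAl2019, §2.1.2 (2.8)] -/
theorem theta3_second_order :
    (fun τ : ℍ => theta3 τ - 1 - 2 * qhalf τ) =O[atImInfty] fun τ => expDecayHalf τ ^ 4 := by
  refine IsBigO.of_bound 4 ?_
  have hev : ∀ᶠ τ : ℍ in atImInfty, expDecayHalf τ ^ 4 ≤ 1 / 2 := by
    have h0 : Tendsto (fun τ => expDecayHalf τ ^ 4) atImInfty (𝓝 0) := by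
      simpa using tendsto_expDecayHalf.pow 4
    exact h0.eventually (eventually_le_nhds (by norm_num : (0 : ℝ) < 1 / 2))
  filter_upwards [hev] with τ hτ
  set r : ℝ := expDecayHalf τ with hr
  have hr0 : 0 < r := expDecayHalf_pos τ
  have hr1 : r ≤ 1 := expDecayHalf_le_one τ
  have hr4 : r ^ 4 < 1 := by linarith
  -- `(θ − 1)/2 − q^{1/2} = Σ_{n ≥ 1} (q^{1/2})^{(n+1)²}`
  have hsum := hasSum_nat_jacobiTheta (τ := (τ : ℂ)) τ.im_pos
  have htail : HasSum (fun n : ℕ => qhalf τ ^ ((n + 1 + 1) ^ 2)) ((jacobiTheta (τ : ℂ) - 1) / 2 - qhalf τ) := by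
    have := (hasSum_nat_add_iff' 1).mpr hsum
    simp only [Finset.range_one, Finset.sum_singleton, Nat.cast_zero, zero_add, one_pow, mul_one] at this
    have key : ∀ n : ℕ, cexp (π * I * (((n + 1 : ℕ) : ℂ) + 1) ^ 2 * τ) = qhalf τ ^ ((n + 1 + 1) ^ 2) :=
      fun n => cexp_sq_eq_qhalf_pow τ (n + 1)
    simp only [key] at this
    exact this
  -- geometric majorant `r^{4(n+1)}`
  have hgeo : HasSum (fun n : ℕ => (r ^ 4) ^ (n + 1)) (r ^ 4 / (1 - r ^ 4)) := by
    have := (hasSum_geometric_of_lt_one (pow_nonneg hr0.le 4) hr4).mul_left (r ^ 4)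
    simp only [← pow_succ'] at this
    rw [div_eq_mul_inv]
    exact this
  have hbound : ‖(jacobiTheta (τ : ℂ) - 1) / 2 - qhalf τ‖ ≤ r ^ 4 / (1 - r ^ 4) := by
    rw [← htail.tsum_eq]
    refine tsum_of_norm_bounded hgeo fun n => ?_
    rw [norm_pow, norm_qhalf, ← hr, ← pow_mul]
    refine pow_le_pow_of_le_one hr0.le hr1 ?_
    nlinarith
  have hθ : theta3 τ - 1 - 2 * qhalf τ = 2 * ((jacobiTheta (τ : ℂ) - 1) / 2 - qhalf τ) := by
    rw [show theta3 (τ : ℂ) = jacobiTheta (τ : ℂ) from (jacobiTheta_eq_jacobiTheta₂ _).symm]; ring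
  rw [hθ, norm_mul, show ‖(2 : ℂ)‖ = 2 by norm_num, Real.norm_of_nonneg (pow_nonneg hr0.le 4)]
  have h1 : r ^ 4 / (1 - r ^ 4) ≤ 2 * r ^ 4 := by
    rw [div_le_iff₀ (by linarith)]; nlinarith [pow_nonneg hr0.le 4]
  linarith

/-! ## `U = 1 + 8q^{1/2} + O(q)`, `W = 1 − 8q^{1/2} + O(q)` -/

/-- **`U − 1 − 8q^{1/2} = O(q)`** (CKMRV (2.8)). [cite: CohnEtAl2019, §2.1.2 (2.8)] -/
theorem thetaU_second_order :
    (fun τ : ℍ => thetaU τ - 1 - 8 * qhalf τ) =O[atImInfty] fun τ => expDecayHalf τ ^ 2 := by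
  -- `θ = 1 + 2b + r`, `U = θ⁴`; `U − 1 − 8b` is a polynomial in `b, r` with every monomial
  -- divisible by `b²` or `r`
  have hr := theta3_second_order
  have hq1 : (fun τ => qhalf τ) =O[atImInfty] fun _ : ℍ => (1 : ℝ) :=
    IsBigO.of_bound 1 (Eventually.of_forall fun τ => by simp [norm_qhalf, expDecayHalf_le_one τ])
  have hq : (fun τ => qhalf τ) =O[atImInfty] fun τ => expDecayHalf τ :=
    IsBigO.of_bound 1 (Eventually.of_forall fun τ => by
      rw [norm_qhalf, Real.norm_of_nonneg (expDecayHalf_pos τ).le, one_mul])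
  have h4le2 : (fun τ => expDecayHalf τ ^ 4) =O[atImInfty] fun τ => expDecayHalf τ ^ 2 :=
    IsBigO.of_bound 1 (Eventually.of_forall fun τ => by
      rw [Real.norm_of_nonneg (pow_nonneg (expDecayHalf_pos τ).le _),
        Real.norm_of_nonneg (pow_nonneg (expDecayHalf_pos τ).le _), one_mul]
      exact pow_le_pow_of_le_one (expDecayHalf_pos τ).le (expDecayHalf_le_one τ) (by norm_num))
  have hr2 : (fun τ : ℍ => theta3 τ - 1 - 2 * qhalf τ) =O[atImInfty] fun τ => expDecayHalf τ ^ 2 := hr.trans h4le2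
  have hr1 : (fun τ : ℍ => theta3 τ - 1 - 2 * qhalf τ) =O[atImInfty] fun _ : ℍ => (1 : ℝ) :=
    hr2.trans (IsBigO.of_bound 1 (Eventually.of_forall fun τ => by
      rw [Real.norm_of_nonneg (sq_nonneg _), norm_one, one_mul]
      exact pow_le_one₀ (expDecayHalf_pos τ).le (expDecayHalf_le_one τ)))
  have hbb : (fun τ => qhalf τ * qhalf τ) =O[atImInfty] fun τ => expDecayHalf τ ^ 2 := by
    simpa [sq] using hq.mul hq
  -- `U − 1 − 8b = r·P + b²·Q` with `P, Q` bounded:  expand `(1 + 2b + r)⁴ − 1 − 8b`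
  set R : ℍ → ℂ := fun τ => theta3 τ - 1 - 2 * qhalf τ with hR
  have hform : ∀ τ : ℍ, thetaU τ - 1 - 8 * qhalf τ =
      R τ * (4 + 6 * R τ + 4 * R τ ^ 2 + R τ ^ 3 + 24 * qhalf τ + 24 * qhalf τ * R τ + 8 * qhalf τ * R τ ^ 2 +
        48 * qhalf τ ^ 2 + 24 * qhalf τ ^ 2 * R τ + 32 * qhalf τ ^ 3) +
      qhalf τ * qhalf τ * (24 + 32 * qhalf τ + 16 * qhalf τ ^ 2) := by
    intro τ
    rw [thetaU_apply, show theta3 (τ : ℂ) = 1 + 2 * qhalf τ + R τ by rw [hR]; ring]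
    ring
  have hP : (fun τ => 4 + 6 * R τ + 4 * R τ ^ 2 + R τ ^ 3 + 24 * qhalf τ + 24 * qhalf τ * R τ + 8 * qhalf τ * R τ ^ 2 +
        48 * qhalf τ ^ 2 + 24 * qhalf τ ^ 2 * R τ + 32 * qhalf τ ^ 3) =O[atImInfty] fun _ : ℍ => (1 : ℝ) := by
    have c : (fun _ : ℍ => (4 : ℂ)) =O[atImInfty] fun _ : ℍ => (1 : ℝ) := isBigO_const_const _ one_ne_zero _
    have m1 := hr1.const_mul_left 6
    have m2 : (fun τ => 4 * R τ ^ 2) =O[atImInfty] fun _ : ℍ => (1 : ℝ) := by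
      simpa [sq] using (hr1.mul hr1).const_mul_left 4
    have m3 : (fun τ => R τ ^ 3) =O[atImInfty] fun _ : ℍ => (1 : ℝ) := by
      simpa [pow_succ] using (hr1.mul hr1).mul hr1
    have m4 := hq1.const_mul_left 24
    have m5 : (fun τ => 24 * qhalf τ * R τ) =O[atImInfty] fun _ : ℍ => (1 : ℝ) := by
      simpa [mul_assoc] using (hq1.mul hr1).const_mul_left 24
    have m6 : (fun τ => 8 * qhalf τ * R τ ^ 2) =O[atImInfty] fun _ : ℍ => (1 : ℝ) := by
      simpa [mul_assoc, sq] using (hq1.mul (hr1.mul hr1)).const_mul_left 8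
    have m7 : (fun τ => 48 * qhalf τ ^ 2) =O[atImInfty] fun _ : ℍ => (1 : ℝ) := by
      simpa [sq] using (hq1.mul hq1).const_mul_left 48
    have m8 : (fun τ => 24 * qhalf τ ^ 2 * R τ) =O[atImInfty] fun _ : ℍ => (1 : ℝ) := by
      simpa [mul_assoc, sq] using ((hq1.mul hq1).mul hr1).const_mul_left 24
    have m9 : (fun τ => 32 * qhalf τ ^ 3) =O[atImInfty] fun _ : ℍ => (1 : ℝ) := by
      simpa [pow_succ, mul_assoc] using ((hq1.mul hq1).mul hq1).const_mul_left 32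
    exact ((((((((c.add m1).add m2).add m3).add m4).add m5).add m6).add m7).add m8).add m9
  have hQ : (fun τ => 24 + 32 * qhalf τ + 16 * qhalf τ ^ 2) =O[atImInfty] fun _ : ℍ => (1 : ℝ) := by
    have c : (fun _ : ℍ => (24 : ℂ)) =O[atImInfty] fun _ : ℍ => (1 : ℝ) := isBigO_const_const _ one_ne_zero _
    have m7 : (fun τ => 16 * qhalf τ ^ 2) =O[atImInfty] fun _ : ℍ => (1 : ℝ) := by
      simpa [sq] using (hq1.mul hq1).const_mul_left 16
    exact (c.add (hq1.const_mul_left 32)).add m7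
  have t1 : (fun τ => R τ * (4 + 6 * R τ + 4 * R τ ^ 2 + R τ ^ 3 + 24 * qhalf τ + 24 * qhalf τ * R τ +
      8 * qhalf τ * R τ ^ 2 + 48 * qhalf τ ^ 2 + 24 * qhalf τ ^ 2 * R τ + 32 * qhalf τ ^ 3)) =O[atImInfty]
      fun τ => expDecayHalf τ ^ 2 := by
    simpa using hr2.mul hP
  have t2 : (fun τ => qhalf τ * qhalf τ * (24 + 32 * qhalf τ + 16 * qhalf τ ^ 2)) =O[atImInfty]
      fun τ => expDecayHalf τ ^ 2 := by
    simpa using hbb.mul hQ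
  exact (t1.add t2).congr' (Eventually.of_forall fun τ => (hform τ).symm) EventuallyEq.rfl

/-- `W(τ) = U(τ + 1)`. [folklore] -/
theorem thetaW_eq_thetaU_vadd (τ : ℍ) : thetaW τ = thetaU ((1 : ℝ) +ᵥ τ) := (thetaU_vadd_one τ).symm

/-- **`W − 1 + 8q^{1/2} = O(q)`** (CKMRV (2.8)), from `W(τ) = U(τ+1)`, `q^{1/2}(τ+1) = −q^{1/2}(τ)`.
[cite: CohnEtAl2019, §2.1.2 (2.8)] -/
theorem thetaW_second_order :
    (fun τ : ℍ => thetaW τ - 1 + 8 * qhalf τ) =O[atImInfty] fun τ => expDecayHalf τ ^ 2 := by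
  have h := thetaU_second_order.comp_tendsto (tendsto_vadd_atImInfty 1)
  refine (h.congr_left fun τ => ?_).congr_right fun τ => ?_
  · simp only [Function.comp_apply, thetaW_eq_thetaU_vadd, qhalf_vadd_one]; ring
  · simp only [Function.comp_apply, expDecayHalf_vadd]

/-! ## `V = 16q^{1/2} + O(q^{3/2})` -/

/-- `V = q^{1/2} · θ(τ/2, τ)⁴` (`θ₁₀ = e^{πiτ/4}θ(τ/2,τ)`). [folklore] -/
theorem thetaV_eq_qhalf_mul (τ : ℍ) : thetaV τ = qhalf τ * jacobiTheta₂ ((τ : ℂ) / 2) τ ^ 4 := by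
  rw [thetaV_apply, show theta2 (τ : ℂ) = cexp (π * I * τ / 4) * jacobiTheta₂ ((τ : ℂ) / 2) τ from rfl, mul_pow,
    ← Complex.exp_nat_mul, qhalf]
  congr 2; push_cast; ring

/-- **`V − 16q^{1/2} = O(|q^{1/2}|³)`** (CKMRV (2.8): `V = 16q^{1/2} + 64q^{3/2} + ⋯`).
[cite: CohnEtAl2019, §2.1.2 (2.8)] -/
theorem thetaV_second_order :
    (fun τ : ℍ => thetaV τ - 16 * qhalf τ) =O[atImInfty] fun τ => expDecayHalf τ ^ 3 := by
  set K : ℝ := Real.exp (2 * π) * ∑' n : ℤ, majorant 0 n with hK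
  -- `J → 2`, so `‖(J+2)(J²+4)‖ ≤ 40` eventually
  have hJ : Tendsto (fun τ : ℍ => jacobiTheta₂ ((τ : ℂ) / 2) τ) atImInfty (𝓝 2) := by
    have := tendsto_jacobiTheta₂_half.comp UpperHalfPlane.tendsto_coe_atImInfty
    exact this
  have hev1 : ∀ᶠ τ : ℍ in atImInfty, ‖jacobiTheta₂ ((τ : ℂ) / 2) τ‖ ≤ 3 := by
    have := (continuous_norm.tendsto (2 : ℂ)).comp hJ
    have h3 : ‖(2 : ℂ)‖ < 3 := by norm_num
    exact this.eventually (eventually_le_nhds h3)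
  have hev2 : ∀ᶠ τ : ℍ in atImInfty, 1 ≤ τ.im := by
    rw [Filter.Eventually, atImInfty_mem]; exact ⟨1, fun τ h => h⟩
  have hK0 : 0 ≤ K := mul_nonneg (Real.exp_pos _).le (tsum_nonneg fun n => majorant_nonneg 0 n)
  refine IsBigO.of_bound (K * 65) ?_
  filter_upwards [hev1, hev2] with τ hJ3 hτ
  set J : ℂ := jacobiTheta₂ ((τ : ℂ) / 2) τ with hJdef
  have hJ2 : ‖J - 2‖ ≤ Real.exp (-2 * π * τ.im) * K := by
    have := norm_jacobiTheta₂_half_sub_two_le (τ := (τ : ℂ)) (by simpa using hτ)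
    simpa [hK, UpperHalfPlane.coe_im] using this
  have hform : thetaV τ - 16 * qhalf τ = qhalf τ * ((J - 2) * ((J + 2) * (J ^ 2 + 4))) := by
    rw [thetaV_eq_qhalf_mul]; ring
  have h1 : ‖J + 2‖ ≤ 5 := (norm_add_le _ _).trans (by norm_num; linarith)
  have h2 : ‖J ^ 2 + 4‖ ≤ 13 := by
    refine (norm_add_le _ _).trans ?_
    rw [norm_pow]
    have : ‖J‖ ^ 2 ≤ 9 := by nlinarith [norm_nonneg J]
    norm_num; linarith
  have hfac : ‖(J + 2) * (J ^ 2 + 4)‖ ≤ 65 := by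
    rw [norm_mul]; nlinarith [norm_nonneg (J + 2), norm_nonneg (J ^ 2 + 4)]
  have hexp : Real.exp (-2 * π * τ.im) = expDecayHalf τ ^ 2 := by
    rw [← expDecay_eq_sq]; rfl
  rw [hform, norm_mul, norm_mul, norm_qhalf, Real.norm_of_nonneg (pow_nonneg (expDecayHalf_pos τ).le 3)]
  have hr0 := expDecayHalf_pos τ
  rw [hexp] at hJ2
  calc expDecayHalf τ * (‖J - 2‖ * ‖(J + 2) * (J ^ 2 + 4)‖)
      ≤ expDecayHalf τ * ((expDecayHalf τ ^ 2 * K) * 65) := by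
        refine mul_le_mul_of_nonneg_left ?_ hr0.le
        exact mul_le_mul hJ2 hfac (norm_nonneg _) (mul_nonneg (sq_nonneg _) hK0)
    _ = K * 65 * expDecayHalf τ ^ 3 := by ring

/-! ## `λ = 16q^{1/2} − 128q + O(q^{3/2})`, `𝓛_S = −16q^{1/2} + O(q)`, `𝓛 = πiτ + log 16 − 8q^{1/2} + O(q)` -/

/-- Useful comparisons: `q^{1/2} = O(e^{−πy})`, `e^{−πy} ≤ 1`. [folklore] -/
theorem qhalf_isBigO : (fun τ => qhalf τ) =O[atImInfty] fun τ => expDecayHalf τ :=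
  IsBigO.of_bound 1 (Eventually.of_forall fun τ => by
    rw [norm_qhalf, Real.norm_of_nonneg (expDecayHalf_pos τ).le, one_mul])

/-- `e^{−mπy} = O(e^{−nπy})` for `n ≤ m`. [folklore] -/
theorem expDecayHalf_pow_isBigO_pow {m n : ℕ} (h : n ≤ m) :
    (fun τ => expDecayHalf τ ^ m) =O[atImInfty] fun τ => expDecayHalf τ ^ n :=
  IsBigO.of_bound 1 (Eventually.of_forall fun τ => by
    rw [Real.norm_of_nonneg (pow_nonneg (expDecayHalf_pos τ).le _),
      Real.norm_of_nonneg (pow_nonneg (expDecayHalf_pos τ).le _), one_mul]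
    exact pow_le_pow_of_le_one (expDecayHalf_pos τ).le (expDecayHalf_le_one τ) h)

/-- `e^{−mπy} = O(e^{−πy})` for `m ≥ 1`. [folklore] -/
theorem expDecayHalf_pow_isBigO {m : ℕ} (h : 1 ≤ m) :
    (fun τ => expDecayHalf τ ^ m) =O[atImInfty] fun τ => expDecayHalf τ :=
  (expDecayHalf_pow_isBigO_pow h).congr_right fun _ => pow_one _

/-- `U − 1 = O(q^{1/2})`. [cite: CohnEtAl2019, §2.1.2 (2.8)] -/
theorem thetaU_sub_one_isBigO : (fun τ : ℍ => thetaU τ - 1) =O[atImInfty] fun τ => expDecayHalf τ := by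
  have h := thetaU_second_order.trans (expDecayHalf_pow_isBigO (m := 2) (by norm_num))
  have h8 : (fun τ => 8 * qhalf τ) =O[atImInfty] fun τ => expDecayHalf τ := qhalf_isBigO.const_mul_left 8
  exact (h.add h8).congr_left fun τ => by ring

/-- Division by `U → 1`: `f = O(g)` ⟹ `f/U = O(g)`. [folklore] -/
theorem isBigO_div_thetaU {f : ℍ → ℂ} {g : ℍ → ℝ} (hf : f =O[atImInfty] g) :
    (fun τ => f τ / thetaU τ) =O[atImInfty] g := by
  have hU : Tendsto thetaU atImInfty (𝓝 1) := tendsto_thetaU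
  have hev : ∀ᶠ τ : ℍ in atImInfty, 1 / 2 ≤ ‖thetaU τ‖ := by
    have := (continuous_norm.tendsto (1 : ℂ)).comp hU
    rw [norm_one] at this
    exact this.eventually (eventually_ge_nhds (by norm_num : (1 / 2 : ℝ) < 1))
  have hinv : (fun τ => (thetaU τ)⁻¹) =O[atImInfty] fun _ : ℍ => (1 : ℝ) := by
    refine IsBigO.of_bound 2 ?_
    filter_upwards [hev] with τ hτ
    rw [norm_inv, norm_one, mul_one]
    have hpos : 0 < ‖thetaU τ‖ := by linarith
    rw [inv_le_comm₀ hpos (by norm_num)]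
    linarith
  have := hf.mul hinv
  simpa [div_eq_mul_inv] using this

/-- **`λ − 16q^{1/2} + 128q = O(|q^{1/2}|³)`** (CKMRV (2.9): `λ = 16q^{1/2} − 128q + 704q^{3/2} + ⋯`):
`λ = V/U` with `V − 16q^{1/2}U + 128qU = (V − 16q^{1/2}) − 16q^{1/2}(U − 1 − 8q^{1/2}) + 128q(U − 1)`.
[cite: CohnEtAl2019, §2.1.2 (2.9)] -/
theorem modularLambda_second_order :
    (fun τ : ℍ => modularLambda τ - 16 * qhalf τ + 128 * qhalf τ ^ 2) =O[atImInfty] fun τ => expDecayHalf τ ^ 3 := by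
  have hV := thetaV_second_order
  have hU := thetaU_second_order
  have hU1 := thetaU_sub_one_isBigO
  have hq := qhalf_isBigO
  have hN : (fun τ => (thetaV τ - 16 * qhalf τ) - 16 * qhalf τ * (thetaU τ - 1 - 8 * qhalf τ) +
      128 * qhalf τ ^ 2 * (thetaU τ - 1)) =O[atImInfty] fun τ => expDecayHalf τ ^ 3 := by
    refine (hV.sub ?_).add ?_
    · have := (hq.mul hU).const_mul_left 16
      refine (this.congr_left fun τ => by ring).congr_right fun τ => by ring
    · have := ((hq.mul hq).mul hU1).const_mul_left 128
      refine (this.congr_left fun τ => by ring).congr_right fun τ => by ring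
  refine (isBigO_div_thetaU hN).congr' ?_ EventuallyEq.rfl
  filter_upwards with τ
  have hU0 := thetaU_ne_zero τ
  simp only [modularLambda]
  field_simp
  ring

/-- `λ = O(q^{1/2})`. [cite: CohnEtAl2019, §2.1.2 (2.9)] -/
theorem modularLambda_isBigO : modularLambda =O[atImInfty] fun τ => expDecayHalf τ := by
  have h := modularLambda_second_order.trans (expDecayHalf_pow_isBigO (m := 3) (by norm_num))
  have hq := qhalf_isBigO
  have hq2 : (fun τ => qhalf τ ^ 2) =O[atImInfty] fun τ => expDecayHalf τ := by
    have h1 : (fun τ => qhalf τ ^ 2) =O[atImInfty] fun τ => expDecayHalf τ ^ 2 := by simpa [sq] using hq.mul hq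
    exact h1.trans (expDecayHalf_pow_isBigO (m := 2) (by norm_num))
  have h16 : (fun τ => 16 * qhalf τ) =O[atImInfty] fun τ => expDecayHalf τ := hq.const_mul_left 16
  have h128 : (fun τ => 128 * qhalf τ ^ 2) =O[atImInfty] fun τ => expDecayHalf τ := hq2.const_mul_left 128
  exact ((h.add h16).sub h128).congr_left fun τ => by ring

/-- `λ − 16q^{1/2} = O(q)`. [cite: CohnEtAl2019, §2.1.2 (2.9)] -/
theorem modularLambda_sub_isBigO :
    (fun τ : ℍ => modularLambda τ - 16 * qhalf τ) =O[atImInfty] fun τ => expDecayHalf τ ^ 2 := by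
  have h := modularLambda_second_order.trans (expDecayHalf_pow_isBigO_pow (m := 3) (n := 2) (by norm_num))
  have hq := qhalf_isBigO
  have hq2 : (fun τ => 128 * qhalf τ ^ 2) =O[atImInfty] fun τ => expDecayHalf τ ^ 2 := by
    simpa [sq] using (hq.mul hq).const_mul_left 128
  exact (h.sub hq2).congr_left fun τ => by ring

/-- `log(1 + z) − z = O(z²)` transported: if `w = O(e^{−πy})` along `atImInfty` then
`log(1 + w) − w = O(e^{−2πy})`. [folklore] -/
theorem log_one_add_sub_isBigO {w : ℍ → ℂ} (hw : w =O[atImInfty] fun τ => expDecayHalf τ) :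
    (fun τ => Complex.log (1 + w τ) - w τ) =O[atImInfty] fun τ => expDecayHalf τ ^ 2 := by
  have hw0 : Tendsto w atImInfty (𝓝 0) := by
    have := hw.trans_tendsto tendsto_expDecayHalf
    exact this
  have hev : ∀ᶠ τ : ℍ in atImInfty, ‖w τ‖ ≤ 1 / 2 := by
    have := (continuous_norm.tendsto (0 : ℂ)).comp hw0
    rw [norm_zero] at this
    exact this.eventually (eventually_le_nhds (by norm_num : (0 : ℝ) < 1 / 2))
  have h2 : (fun τ => Complex.log (1 + w τ) - w τ) =O[atImInfty] fun τ => ‖w τ‖ ^ 2 := by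
    refine IsBigO.of_bound 1 ?_
    filter_upwards [hev] with τ hτ
    have h := Complex.norm_log_one_add_sub_self_le (z := w τ) (by linarith)
    rw [Real.norm_of_nonneg (sq_nonneg _), one_mul]
    refine h.trans ?_
    have : (1 - ‖w τ‖)⁻¹ ≤ 2 := by
      rw [inv_le_comm₀ (by linarith) (by norm_num)]; linarith
    nlinarith [sq_nonneg ‖w τ‖]
  have h3 : (fun τ => ‖w τ‖ ^ 2) =O[atImInfty] fun τ => expDecayHalf τ ^ 2 := by
    have := hw.norm_left.pow 2
    simpa using this
  exact h2.trans h3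

/-- **`𝓛_S + 16q^{1/2} = O(q)`** (CKMRV (2.10): `𝓛_S = −16q^{1/2} − (64/3)q^{3/2} + ⋯`): near `i∞`,
`𝓛_S = log(1 − λ)` (the branch tending to `0`) and `log(1 − λ) + λ = O(λ²)`. [cite: CohnEtAl2019, §2.1.2 (2.10)] -/
theorem logLambdaS_second_order :
    (fun τ : ℍ => logLambdaS τ + 16 * qhalf τ) =O[atImInfty] fun τ => expDecayHalf τ ^ 2 := by
  have hl := modularLambda_isBigO
  -- eventually `𝓛_S = log(1 − λ)`
  have hev : ∀ᶠ τ : ℍ in atImInfty, logLambdaS τ = Complex.log (1 + -modularLambda τ) := by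
    have h0 := tendsto_logLambdaS_atImInfty
    have : ∀ᶠ τ : ℍ in atImInfty, ‖logLambdaS τ‖ < 1 := by
      have := (continuous_norm.tendsto (0 : ℂ)).comp h0
      rw [norm_zero] at this
      exact this.eventually (eventually_lt_nhds (by norm_num : (0 : ℝ) < 1))
    filter_upwards [this] with τ hτ
    have him : |(logLambdaS τ).im| < π := by
      have := (abs_im_le_norm (logLambdaS τ)).trans_lt hτ
      linarith [Real.pi_gt_three]
    rw [← sub_eq_add_neg, ← cexp_logLambdaS τ, Complex.log_exp (by linarith [abs_lt.1 him |>.1])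
      (by linarith [abs_lt.1 him |>.2])]
  have h1 := log_one_add_sub_isBigO (w := fun τ => -modularLambda τ) hl.neg_left
  have h2 := modularLambda_sub_isBigO
  -- `𝓛_S + 16q^{1/2} = (log(1−λ) + λ) − (λ − 16q^{1/2})`
  refine (h1.sub h2).congr' ?_ EventuallyEq.rfl
  filter_upwards [hev] with τ hτ
  rw [hτ]; ring

/-- **`𝓛 − πiτ − log 16 + 8q^{1/2} = O(q)`** (CKMRV (2.10): `𝓛 = πiτ + 4log 2 − 8q^{1/2} + 32q − ⋯`):
near `i∞`, `𝓛 − πiτ − log 16 = log(λe^{−πiτ}/16)` and `λe^{−πiτ}/16 = 1 − 8q^{1/2} + O(q)`.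
[cite: CohnEtAl2019, §2.1.2 (2.10)] -/
theorem logLambda_second_order :
    (fun τ : ℍ => logLambda τ - π * I * τ - (Real.log 16 : ℝ) + 8 * qhalf τ) =O[atImInfty]
      fun τ => expDecayHalf τ ^ 2 := by
  -- `w = λe^{−πiτ}/16 − 1`
  set w : ℍ → ℂ := fun τ => modularLambda τ * cexp (-(π * I * τ)) / 16 - 1 with hw
  have hq0 : ∀ τ : ℍ, qhalf τ ≠ 0 := fun τ => Complex.exp_ne_zero _
  have hqinv : ∀ τ : ℍ, cexp (-(π * I * (τ : ℂ))) = (qhalf τ)⁻¹ := fun τ => by rw [qhalf, Complex.exp_neg]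
  -- `w + 8q^{1/2} = (λ − 16q^{1/2} + 128q)·e^{−πiτ}/16 = O(q)`
  have hw8 : (fun τ => w τ + 8 * qhalf τ) =O[atImInfty] fun τ => expDecayHalf τ ^ 2 := by
    have h := modularLambda_second_order
    obtain ⟨C, hC⟩ := h.bound
    have hform : ∀ τ : ℍ, w τ + 8 * qhalf τ =
        (modularLambda τ - 16 * qhalf τ + 128 * qhalf τ ^ 2) * (qhalf τ)⁻¹ / 16 := by
      intro τ
      have := hq0 τ
      simp only [hw, hqinv]
      field_simp
      ring
    refine IsBigO.of_bound (C / 16) ?_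
    filter_upwards [hC] with τ hτ
    rw [Real.norm_of_nonneg (pow_nonneg (expDecayHalf_pos τ).le 3)] at hτ
    rw [hform, Real.norm_of_nonneg (sq_nonneg _), norm_div, norm_mul, norm_inv, norm_qhalf,
      show ‖(16 : ℂ)‖ = 16 by norm_num]
    have hr := expDecayHalf_pos τ
    rw [div_le_iff₀ (by norm_num : (0 : ℝ) < 16), mul_inv_le_iff₀ hr]
    calc ‖modularLambda τ - 16 * qhalf τ + 128 * qhalf τ ^ 2‖ ≤ C * expDecayHalf τ ^ 3 := hτ
      _ = C / 16 * expDecayHalf τ ^ 2 * 16 * expDecayHalf τ := by ring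
  have hw1 : w =O[atImInfty] fun τ => expDecayHalf τ := by
    have h8 : (fun τ => 8 * qhalf τ) =O[atImInfty] fun τ => expDecayHalf τ := qhalf_isBigO.const_mul_left 8
    have := (hw8.trans (expDecayHalf_pow_isBigO (m := 2) (by norm_num))).sub h8
    exact this.congr_left fun τ => by ring
  have hlog := log_one_add_sub_isBigO hw1
  -- eventually `𝓛 − πiτ − log 16 = log(1 + w)`
  have hev : ∀ᶠ τ : ℍ in atImInfty, logLambda τ - π * I * τ - (Real.log 16 : ℝ) = Complex.log (1 + w τ) := by
    have h0 : Tendsto (fun τ : ℍ => logLambda τ - π * I * τ - (Real.log 16 : ℝ)) atImInfty (𝓝 0) := by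
      have := tendsto_logLambda_sub_atImInfty.sub_const (((Real.log 16 : ℝ)) : ℂ)
      rwa [sub_self] at this
    have : ∀ᶠ τ : ℍ in atImInfty, ‖logLambda τ - π * I * τ - (Real.log 16 : ℝ)‖ < 1 := by
      have := (continuous_norm.tendsto (0 : ℂ)).comp h0
      rw [norm_zero] at this
      exact this.eventually (eventually_lt_nhds (by norm_num : (0 : ℝ) < 1))
    filter_upwards [this] with τ hτ
    set G := logLambda τ - π * I * τ - (Real.log 16 : ℝ) with hG
    have him : |G.im| < π := by
      have := (abs_im_le_norm G).trans_lt hτ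
      linarith [Real.pi_gt_three]
    have h16 : cexp ((Real.log 16 : ℝ) : ℂ) = 16 := by
      rw [← Complex.ofReal_exp, Real.exp_log (by norm_num)]; norm_num
    have hexpG : cexp G = 1 + w τ := by
      rw [hG, sub_eq_add_neg, sub_eq_add_neg, Complex.exp_add, Complex.exp_add, cexp_logLambda,
        Complex.exp_neg ((Real.log 16 : ℝ) : ℂ), h16, hw]
      ring
    rw [← hexpG, Complex.log_exp (by linarith [abs_lt.1 him |>.1]) (by linarith [abs_lt.1 him |>.2])]
  refine (hlog.add hw8).congr' ?_ EventuallyEq.rfl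
  filter_upwards [hev] with τ hτ
  rw [show logLambda τ - π * I * τ - (Real.log 16 : ℝ) + 8 * qhalf τ =
    (logLambda τ - π * I * τ - (Real.log 16 : ℝ)) + 8 * qhalf τ by ring, hτ]
  ring

end Literature.NumberTheory.ModularForms
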